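import Summits.PneNP.PneNP.Theses.OneSlice
import Summits.PneNP.PneNP.Theorems.OneSliceSliceTargetTransfer
import Summits.PneNP.PneNP.Theorems.OneSliceSliceTargetSliceTouch
import Summits.PneNP.PneNP.Theorems.OneSliceSliceTargetFibreMin
import Summits.PneNP.PneNP.Theorems.OneSliceSliceTargetFibreCliqueLower
import Summits.PneNP.PneNP.Theorems.OneSliceSliceTargetFibreCliqueUpper
import Summits.PneNP.PneNP.Theorems.OneSliceSliceTargetQuarter

/-!
# Line `Sketch-ideator3-r1` for crux `SliceTarget` (stmt-PneNP-2832, route PneNP/OneSlice) — skeleton v9 (slim)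

Crux (by name): `Summit.PneNP.PneNP.Theses.OneSlice.SliceTarget` = X = `∀ c, X(c)`.
Lead prover-line-stmt-PneNP-2832-c2-0 (continuation c2, 2026-08-16), after leads -0 (v1–v6), -1 (v7) and c1-0 (v8).

v9 is v8 with every inlined / proved layer replaced by the import of the module in which it LANDED: the whole line now lives in
`Summits/PneNP/PneNP/Theorems/OneSliceSliceTarget*.lean` (24 accepted files; the composition is also a tree file,
`OneSliceSliceTargetReduction.lean`, p100099 — not imported here only because the farm snapshot had not built it yet at 13:45Z;
its two proofs are repeated verbatim below). What remains here is exactly the registered open stub and the composition: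

* ONE `sorry`: T9 `stub_sliceHardQuarter` (same name and signature as registered by -1 / c1-0) = X(≥2) restricted to circuits in
  the size window `C(n,2) ≤ 4·size + 1`;
* `SliceTarget_of : Registered.stub_sliceHardQuarter → SliceTarget` = the tree theorem `sliceTarget_of_sliceHardQuarter` (same proof)
  (X(0), X(1) by the locality floor `sliceTargetAt_le_one` at `k = 4` — T1 SliceTouch p87365, T2 FibreMin p86862, T3 FibreCliqueLower
  p97074/p97251, T4 FibreCliqueUpper p87716, T6 Transfer p86895; X(≥2) from T9 by the quarter floor `bigBlindFloor` and the window
  reduction `sliceTargetFrom2_of_quarter`, p96336 — B1 Replica p89463, B2 CliqueDensityLower p90570, B3 PairBound p92306);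
* `stub_sliceHardQuarter_of_sliceTarget`: conversely X gives T9 (tree theorem `sliceHardQuarter_of_sliceTarget`), so the registered
  stub is EQUIVALENT to the crux (`sliceTarget_iff_sliceHardQuarter`, tree).

Disproof.lean (cdisprove, 07:21Z) honoured: §1 (basis / centrality / accuracy all load-bearing — all used), §2 witness shape
(`k ≥ c+1`, `δ ≤ 1/k!` — T9 leaves `k(c)`, `δ(c)` free), §4 (`sliceTarget_iff_B2_holds`: from exponent `c₀ + 3` on T9 is a
general-circuit statement), §6 `-- Targets` (T3 guards, T7 shape; nothing on T9).
-/

set_option linter.dupNamespace false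

namespace Summit.PneNP.PneNP.Cruxes.SliceTarget.Ideator3Line

open Literature.Computability.Complexity Finset Filter Classical
open Summit.PneNP.PneNP.Theses.OneSlice (SliceTarget)
open Summit.PneNP.PneNP.Theorems.ConstantBand.Negative (Edge Central slice errSet)

noncomputable section

/-- **T9 `SliceHardQuarter`** (the crux-let): for every exponent `c ≥ 2` there are `k ≥ 3` and `δ > 0` such that eventually in
`n`, on every central slice `j` of the critical window for `k`-cliques, every `{∧₂,∨₂}`-circuit `C` in the size window
`C(n,2) ≤ 4·C.size + 1` that errs against `CLIQUE_k` on at most `δ·#slice_j` graphs of the slice has more than `n^c` gates.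
Equivalent to the crux (`sliceTarget_iff_sliceHardQuarter`). [folklore] -/
def SliceHardQuarter : Prop :=
  ∀ c : ℕ, 2 ≤ c → ∃ k : ℕ, 3 ≤ k ∧ ∃ δ : ℝ, 0 < δ ∧ ∀ᶠ n : ℕ in atTop, ∀ j : ℕ, Central k n j →
    ∀ C : Circuit (Edge n), C.IsOver monotoneBasis → n.choose 2 ≤ 4 * C.size + 1 →
      (#(errSet n k j C) : ℝ) ≤ δ * #(slice n j) → n ^ c < C.size

/-! ## Registered stub (the only open declaration) -/

/-- stub T9 (OPEN, HARDEST — the crux-let): `SliceHardQuarter` expanded. -/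
theorem stub_sliceHardQuarter :
    ∀ c : ℕ, 2 ≤ c → ∃ k : ℕ, 3 ≤ k ∧ ∃ δ : ℝ, 0 < δ ∧ ∀ᶠ n : ℕ in atTop, ∀ j : ℕ, Central k n j →
      ∀ C : Circuit (Edge n), C.IsOver monotoneBasis → n.choose 2 ≤ 4 * C.size + 1 →
        (#(errSet n k j C) : ℝ) ≤ δ * #(slice n j) → n ^ c < C.size := by
  sorry

/-! ## Name-keyed alias (the skeleton audit admits a hypothesis of the composition only if its head constant is a registered
obligation or is NAMED like a declared stub) -/
namespace Registered

/-- Alias of `SliceHardQuarter` keyed by the registered stub name (T9, open). -/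
abbrev stub_sliceHardQuarter : Prop := SliceHardQuarter

end Registered

/-! ## Composition (real proof: the landed reduction) -/

/-- **The composition** (v9): the open obligation T9 implies the crux, concluded BY NAME — `c ≤ 1` by the landed locality floor
(`sliceTargetAt_le_one`, `k = 4`), `c ≥ 2` by the landed quarter floor + window reduction (`sliceTargetFrom2_of_quarter`); both
packaged in the tree theorem `sliceTarget_of_sliceHardQuarter` (Theorems/OneSliceSliceTargetReduction.lean, p100099). -/
theorem SliceTarget_of (h₉ : Registered.stub_sliceHardQuarter) : SliceTarget := by
  intro c
  by_cases hc : c ≤ 1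
  · -- X(0), X(1): the locality floor at `k = 4` (tree: `sliceTargetAt_le_one`)
    obtain ⟨δ, hδ, h⟩ := sliceLB_of_locality hc stub_sliceTouch stub_fibreMin stub_fibreCliqueLower stub_fibreCliqueUpper
    exact ⟨4, by norm_num, δ, hδ, h⟩
  · -- X(≥2): the quarter floor + window reduction fed by T9 (tree: `sliceTargetFrom2_of_quarter`)
    exact sliceTargetFrom2_of_quarter h₉ c (by omega)

/-- Wiring check — the assembled skeleton: the registered stub feeds `SliceTarget_of` as stated. -/
example : SliceTarget :=
  SliceTarget_of stub_sliceHardQuarter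

/-- **Sanity (the stub is not stronger than the crux)**: T9 follows from X (tree theorem `sliceHardQuarter_of_sliceTarget`), so
the line loses nothing: the registered residual is EQUIVALENT to the crux. -/
theorem stub_sliceHardQuarter_of_sliceTarget (hX : SliceTarget) : SliceHardQuarter :=
  quarter_of_sliceTargetFrom2 fun c _ => hX c

/-- The equivalence, restated against this file's `SliceHardQuarter` (tree: `sliceTarget_iff_sliceHardQuarter`, p100099). -/
theorem sliceTarget_iff_stub : SliceTarget ↔ SliceHardQuarter :=
  ⟨stub_sliceHardQuarter_of_sliceTarget, fun h₉ => SliceTarget_of h₉⟩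

end

end Summit.PneNP.PneNP.Cruxes.SliceTarget.Ideator3Line
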